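import Summits.QuantumFields.BalabanUV.T4Continuum.Support.NE3CoercivityScalingPrep
import HarnessLib

/-!
# T⁴ programme, node NE3, row NE3-R2 (gen 5) — NO `k`-UNIFORM TANGENT COERCIVITY IN THE UNWEIGHTED LATTICE ENERGY NORM:
# the kernel certificate of GAPS G-ne7king10-1 (`NE3CoercivityScaling`)

Cell `pub-balaban`, unit `b2b-balaban-t4-ne3r2-p1` (OWNER of `BINDER-OWNERS.md` row NE3-R2), gen 5.  The energy route of NE3
(road P2) types leaf L5 = ML as `NE3HessShapes.TangentCoercive W T N c` (`c·(curlSq + dirSq) ≤ hess`, LATTICE units, weight `1`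
on `dirSq`); its torus assembly `NE3EnergyAssembly.ne3EnergyRate_of_routeLeaves` needs ONE `c > 0` for all levels `k`.  GAPS
G-ne7king10-1 (seat `t4-ne7-ideate-king1986`, 2026-08-20T08:53Z; quoted in the docstring caveat of `NE3HessShapes`) located the
objection «no `k`-uniform `c` in this currency on any `T` containing the constrained Landau tangent space at the flat background»
with a numeric certificate and a non-constructive band-limited witness.  THIS FILE IS THE KERNEL CERTIFICATE, with an EXPLICIT
witness pushed through Bałaban's linearised average (42) (tree contours, frames) by file 1 `NE3TangentFlatPush`; file 2
`NE3CoercivityScalingPrep` supplies §1 `hess 1 X X (plaqsOf F) = curlSq 1 X F` for abelian `X = f·(i·1)` at the flat configuration,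
§2 the zero-mean SAWTOOTH `saw m` (`Σ saw = 0`, `Σ saw² = m(m²−1)/12`, `Σ (Δsaw)² = m(m−1)`: Poincaré scaling `12/(m+1)`), §3
period-box bookkeeping.  THIS FILE, §4 THE WITNESS `sawWave L k` (`d ≥ 2`: slab wave along `e₀`, profile `saw (L^k)` in `x₁`,
times `i·1`): skew, `(N·L^k)`-periodic, flat-Landau (`flatDiv = 0`), non-zero, CONSTRAINT-TANGENT for run A at level `k`
(`TangentIter L (k−1) flatCfg`, by `NE3TangentFlatPush.tangentIter_flatCfg_slabWave`) — `sawWave_mem_flatTangentLandau`; and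
**`tangentCoercive_flatCfg_le`**: `sawWave L k ∈ T → TangentCoercive flatCfg T (periodBox (N·L^k)) c → c ≤ 12/(L^k+1)`, whence
**`not_tangentCoercive_uniform`**: NO `c > 0` with `TangentCoercive flatCfg (flatTangentLandau L N k) (periodBox (N·L^k)) c` for
all `k ≥ 1` (`L ≥ 2`).  READING (record `t4/T4-EST-NE3-R2.md` v0.6): the `k`-free `{c}` of `ne3EnergyRate_of_routeLeaves` is not
instantiable through L5 ∕ `tangentCoercive_of_poincare`'s `hP` in the unweighted norm; the `k`-uniform ML lives in the WEIGHTED norm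
`curlSq + dirSq/(L^k)²` (G-ne7king10-1 REPAIR), where the residual leaf must be re-derived with a GRADIENT-BOUNDED one-step lift —
this row's (γ2)–(γ4), reopened.  Nothing landed is wrong: `TangentCoercive`, `tangentCoercive_of_poincare`,
`ne3EnergyRate_of_routeLeaves` are true as stated; only the `k`-uniform INSTANTIATION is excluded.  All [folklore], 0 sorry.

HONEST FRAMING.  Finite-`T⁴` statement about OUR typed shapes at the flat datum; rung (B)+1; nothing of Bałaban's is asserted or
refuted (B9 Thm 3.3∕3.12 are `k`-uniform in CONTINUUM units — consistent); NE3 NOT proved; NOT infinite volume, NOT mass gap, NOT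
Clay, NOT summit progress.  ABSOLUTE RULE kept: no printed sentence is a hypothesis (context: [Balaban1985Variational] (83) p. 290;
[Balaban1985BackgroundPropagators] Thm 3.3 p. 399).  PLACEMENT: our work, under `Summits/QuantumFields/BalabanUV/`; moves nothing.
-/

set_option autoImplicit false

open scoped BigOperators Matrix Matrix.Norms.L2Operator
open NormedSpace Finset

namespace Summit.QuantumFields.BalabanUV.T4Continuum.NE3CoercivityScaling

open Literature.MathematicalPhysics.QuantumFieldTheory.Balaban1983to89
open B7Prop1Explicit B7Prop2Explicit MatrixLog UnitaryModel MatrixNorms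
open T4AveragingDeficitWall hiding Site Plane Plaq Bond
open T4AveragingDeficitWallBoundary (periodBox)
open AveragingDeficitPeriodicCounting (IsPeriodicDir)
open AveragingDeficitMultiLevelPrep (TangentIter)
open MinimalActionWitness (flatCfg)
open NE3HessForm (hess hessPlaq hessPlaqAt dcurlAt)
open NE3HessShapes (TangentCoercive plaqsOf sum_plaqsOf)
open NE3TangentFlatPush (slabWave shift_mul_period isPeriodicDir_slabWave sum_fun_apply_eq tangentIter_flatCfg_slabWave)
open NE3CoercivityScalingPrep

noncomputable section

variable {d : ℕ} {n : Type*} [Fintype n] [DecidableEq n]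

/-! ## §4 The witness and the scaling bound -/

section Witness

variable (L N k : ℕ)

/-- Direction `e₀` (needs `d ≥ 2`). [folklore] -/
def dir0 (hd : 2 ≤ d) : Fin d := ⟨0, by omega⟩

/-- Direction `e₁` (needs `d ≥ 2`). [folklore] -/
def dir1 (hd : 2 ≤ d) : Fin d := ⟨1, by omega⟩

/-- THE WITNESS: the slab wave along `e₀` with the zero-mean sawtooth profile of period `L^k` in `x₁`, times `i·1`. [folklore] -/
def sawWave (hd : 2 ≤ d) : Site d → Fin d → Matrix n n ℂ :=
  slabWave (dir0 hd) (dir1 hd) (saw (L ^ k)) iOne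

/-- The flat (Landau) divergence `Σ_μ [X(x,μ) − X(x − e_μ, μ)]`. [folklore] -/
def flatDiv (X : Site d → Fin d → Matrix n n ℂ) (x : Site d) : Matrix n n ℂ := ∑ μ : Fin d, (X x μ - X (x - e μ) μ)

variable {L N k}

/-- `e₀ ≠ e₁`. [folklore] -/
theorem dir0_ne_dir1 (hd : 2 ≤ d) : dir0 (d := d) hd ≠ dir1 hd := by
  simp [dir0, dir1, Fin.ext_iff]

omit [Fintype n] [DecidableEq n] in
/-- Slab waves are divergence-free (`i₀ ≠ i₁`). [folklore] -/
theorem flatDiv_slabWave {i₀ i₁ : Fin d} (h01 : i₀ ≠ i₁) (s : ℤ → ℝ) (E : Matrix n n ℂ) (x : Site d) :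
    flatDiv (slabWave i₀ i₁ s E) x = 0 := by
  unfold flatDiv
  refine Finset.sum_eq_zero fun μ _ => ?_
  by_cases hμ : μ = i₀
  · subst hμ; simp [slabWave, e_apply, Ne.symm h01]
  · simp [slabWave, hμ]

/-- The witness is `𝔲(N)`-valued. [folklore] -/
theorem isSkewDir_sawWave (hd : 2 ≤ d) : IsSkewDir (sawWave (n := n) L k hd) := by
  intro x κ
  simp only [sawWave, slabWave]
  exact skewAdjoint.smul_mem _ iOne_mem_skew

omit [Fintype n] in
/-- The witness is `(N·L^k)`-periodic. [folklore] -/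
theorem isPeriodicDir_sawWave (hd : 2 ≤ d) : IsPeriodicDir (sawWave (n := n) L k hd) ((N * L ^ k : ℕ) : ℤ) := by
  have h := isPeriodicDir_slabWave (dir0 hd) (dir1 hd) (m := ((L ^ k : ℕ) : ℤ))
    (fun t => saw_periodic (L ^ k) t) (iOne : Matrix n n ℂ) (N : ℤ)
  simpa [sawWave, Nat.cast_mul] using h

omit [Fintype n] in
/-- The witness is divergence-free. [folklore] -/
theorem flatDiv_sawWave (hd : 2 ≤ d) (x : Site d) : flatDiv (sawWave (n := n) L k hd) x = 0 :=
  flatDiv_slabWave (dir0_ne_dir1 hd) _ _ x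

/-- The witness is CONSTRAINT-TANGENT for run A at level `k` (`k ≥ 1`, `L ≥ 1`). [folklore] -/
theorem tangentIter_sawWave (hd : 2 ≤ d) (hL : 1 ≤ L) (hk : 1 ≤ k) :
    TangentIter L (k - 1) flatCfg (sawWave (n := n) L k hd) :=
  tangentIter_flatCfg_slabWave hL (dir0_ne_dir1 hd) iOne hk
    (fun t => by exact_mod_cast saw_periodic (L ^ k) t) (sum_range_saw (L ^ k))

/-- The witness is non-zero (`L^k ≥ 2`). [folklore] -/
theorem sawWave_ne_zero [Nonempty n] (hd : 2 ≤ d) (hm : 2 ≤ L ^ k) : sawWave (n := n) L k hd ≠ 0 := by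
  intro h
  have h0 := congr_fun (congr_fun h 0) (dir0 hd)
  simp only [sawWave, slabWave, if_true, Pi.zero_apply] at h0
  rw [show (0 : ℤ) = ((0 : ℕ) : ℤ) from rfl, saw_natCast (by omega)] at h0
  have hE : (iOne : Matrix n n ℂ) ≠ 0 := by
    intro hE; have := norm_iOne (n := n); rw [hE, norm_zero] at this; exact zero_ne_one this
  have h2 : (2 : ℝ) ≤ (L : ℝ) ^ k := by exact_mod_cast hm
  have hc : ((0 : ℕ) : ℝ) - (((L ^ k : ℕ) : ℝ) - 1) / 2 ≠ 0 := by
    push_cast; intro h; linarith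
  exact (smul_eq_zero.mp h0).elim hc hE

/-- THE CONSTRAINED LANDAU TANGENT SPACE AT THE FLAT BACKGROUND, level `k`, torus side `N·L^k`: skew, periodic,
constraint-tangent (`TangentIter L (k−1) 1`), flat-divergence-free direction fields — the set over which leaf L5 = ML and
`tangentCoercive_of_poincare`'s `hP` quantify at `W = 1`. [folklore] -/
def flatTangentLandau (L N k : ℕ) : Set (Site d → Fin d → Matrix n n ℂ) :=
  {X | IsSkewDir X ∧ IsPeriodicDir X ((N * L ^ k : ℕ) : ℤ) ∧ TangentIter L (k - 1) flatCfg X ∧ ∀ x, flatDiv X x = 0}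

/-- The witness lies in the constrained Landau tangent space. [folklore] -/
theorem sawWave_mem_flatTangentLandau (hd : 2 ≤ d) (hL : 1 ≤ L) (hk : 1 ≤ k) :
    sawWave (n := n) L k hd ∈ flatTangentLandau (d := d) (n := n) L N k :=
  ⟨isSkewDir_sawWave hd, isPeriodicDir_sawWave hd, tangentIter_sawWave hd hL hk, flatDiv_sawWave hd⟩

/-- The profile of the witness as a real field. [folklore] -/
def sawProf (L k : ℕ) (hd : 2 ≤ d) (x : Site d) (μ : Fin d) : ℝ :=
  if μ = dir0 hd then saw (L ^ k) (x (dir1 hd)) else 0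

omit [Fintype n] in
/-- The witness is the profile times `i·1`. [folklore] -/
theorem sawWave_eq_prof (hd : 2 ≤ d) : sawWave (n := n) L k hd = fun x μ => sawProf L k hd x μ • iOne := rfl

/-- The `dirSq` of the witness: `P^{d−1}·N·Σ_{t<L^k} saw²`. [folklore] -/
theorem dirSq_sawWave [Nonempty n] (hd : 2 ≤ d) :
    dirSq (sawWave (n := n) L k hd) (periodBox (N * L ^ k))
      = ((N * L ^ k : ℕ) : ℝ) ^ (d - 1) * ((N : ℝ) * ∑ t ∈ Finset.range (L ^ k), saw (L ^ k) (t : ℤ) ^ 2) := by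
  unfold dirSq
  have hin : ∀ z ∈ periodBox (d := d) (N * L ^ k), ∑ κ : Fin d, ‖sawWave (n := n) L k hd z κ‖ ^ 2
      = saw (L ^ k) (z (dir1 hd)) ^ 2 := by
    intro z _
    rw [Finset.sum_eq_single (dir0 hd) (fun κ _ hκ => by simp [sawWave, slabWave, hκ]) (fun h => (h (Finset.mem_univ _)).elim)]
    simp [sawWave, slabWave, norm_smul, norm_iOne, sq_abs]
  rw [Finset.sum_congr rfl hin, sum_periodBox_apply (N * L ^ k) (dir1 hd) (fun t => saw (L ^ k) t ^ 2),
    sum_range_mul_of_periodic (fun t => saw (L ^ k) t ^ 2) (L ^ k) (fun t => by simp only [saw_periodic]) N]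

/-- The `curlSq` of the witness at the flat background: `P^{d−1}·N·Σ_{t<L^k} (Δsaw)²`. [folklore] -/
theorem curlSq_sawWave [Nonempty n] (hd : 2 ≤ d) :
    curlSq (flatCfg (d := d) (n := n)) (sawWave (n := n) L k hd) (periodBox (N * L ^ k))
      = ((N * L ^ k : ℕ) : ℝ) ^ (d - 1)
        * ((N : ℝ) * ∑ t ∈ Finset.range (L ^ k), (saw (L ^ k) ((t : ℤ) + 1) - saw (L ^ k) (t : ℤ)) ^ 2) := by
  unfold curlSq
  let π₀ : T4AveragingDeficitWall.Plane d := ⟨(dir0 hd, dir1 hd), by simp [dir0, dir1, Fin.lt_def]⟩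
  have hval : ∀ (z : Site d) (π : T4AveragingDeficitWall.Plane d),
      curl (flatCfg (d := d) (n := n)) (sawWave (n := n) L k hd) (z, π)
        = (sawProf L k hd z π.1.1 + sawProf L k hd (z + e π.1.1) π.1.2 - sawProf L k hd (z + e π.1.2) π.1.1
            - sawProf L k hd z π.1.2) • iOne := by
    intro z π; rw [curl, sawWave_eq_prof, curlAt_flatCfg_prof]
  have hin : ∀ z ∈ periodBox (d := d) (N * L ^ k),
      ∑ π : T4AveragingDeficitWall.Plane d, ‖curl (flatCfg (d := d) (n := n)) (sawWave (n := n) L k hd) (z, π)‖ ^ 2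
        = (saw (L ^ k) (z (dir1 hd) + 1) - saw (L ^ k) (z (dir1 hd))) ^ 2 := by
    intro z _
    rw [Finset.sum_eq_single π₀]
    · rw [hval, norm_smul, norm_iOne, mul_one, Real.norm_eq_abs, sq_abs]
      simp [π₀, sawProf, (dir0_ne_dir1 hd).symm, e_apply]
      ring
    · intro π _ hπ
      rw [hval, norm_smul, norm_iOne, mul_one, Real.norm_eq_abs, sq_abs]
      obtain ⟨⟨μ, ν⟩, hμν⟩ := π
      have h0 : dir0 (d := d) hd = ⟨0, by omega⟩ := rfl
      have h1 : dir1 (d := d) hd = ⟨1, by omega⟩ := rfl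
      by_cases hμ : μ = dir0 hd
      · subst hμ
        have hν1 : ν ≠ dir1 hd := by
          rintro rfl; exact hπ rfl
        have hν0 : ν ≠ dir0 hd := ne_of_gt hμν
        simp [sawProf, hν0, e_apply, Ne.symm hν1]
      · have hν0 : ν ≠ dir0 hd := by
          intro hν; rw [hν, h0, Fin.lt_def] at hμν; simp at hμν
        simp [sawProf, hμ, hν0]
    · intro h; exact (h (Finset.mem_univ _)).elim
  rw [Finset.sum_congr rfl hin,
    sum_periodBox_apply (N * L ^ k) (dir1 hd) (fun t => (saw (L ^ k) (t + 1) - saw (L ^ k) t) ^ 2),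
    sum_range_mul_of_periodic (fun t => (saw (L ^ k) (t + 1) - saw (L ^ k) t) ^ 2) (L ^ k)
      (fun t => by simp only [show t + ((L ^ k : ℕ) : ℤ) + 1 = (t + 1) + ((L ^ k : ℕ) : ℤ) by ring, saw_periodic]) N]

/-- **THE SCALING BOUND.**  If a set `T` of directions contains the witness and the Wilson Hessian at the flat background
is `c`-coercive on `T` in the unweighted lattice energy norm over one period `[0, N·L^k)^d`, then `c ≤ 12/(L^k + 1)`.
[folklore] -/
theorem tangentCoercive_flatCfg_le [Nonempty n] (hd : 2 ≤ d) (hL : 2 ≤ L) (hk : 1 ≤ k) (hN : 1 ≤ N)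
    {T : Set (Site d → Fin d → Matrix n n ℂ)} {c : ℝ} (hT : sawWave (n := n) L k hd ∈ T)
    (h : TangentCoercive (flatCfg (d := d) (n := n)) T (periodBox (N * L ^ k)) c) :
    c ≤ 12 / ((L : ℝ) ^ k + 1) := by
  set m : ℕ := L ^ k with hm
  have hm2 : 2 ≤ m := by
    rw [hm]; calc 2 ≤ L := hL
      _ = L ^ 1 := (pow_one L).symm
      _ ≤ L ^ k := Nat.pow_le_pow_right (by omega) hk
  have hmR : (2 : ℝ) ≤ (m : ℝ) := by exact_mod_cast hm2
  have hmpos : (0 : ℝ) < (m : ℝ) + 1 := by linarith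
  have hLk : (L : ℝ) ^ k = (m : ℝ) := by rw [hm]; push_cast; ring
  rw [hLk]
  -- the coercivity inequality on the witness, with `hess = curlSq`
  have hX := h _ hT
  rw [sawWave_eq_prof, hess_flatCfg_iWave, ← sawWave_eq_prof, curlSq_sawWave, dirSq_sawWave] at hX
  set K : ℝ := ((N * L ^ k : ℕ) : ℝ) ^ (d - 1) * (N : ℝ) with hK
  set A : ℝ := ∑ t ∈ Finset.range m, (saw m ((t : ℤ) + 1) - saw m (t : ℤ)) ^ 2 with hA
  set B : ℝ := ∑ t ∈ Finset.range m, saw m (t : ℤ) ^ 2 with hB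
  have hAval : A = (m : ℝ) * ((m : ℝ) - 1) := sum_range_dsaw_sq (by omega)
  have hBval : B = (m : ℝ) * ((m : ℝ) ^ 2 - 1) / 12 := sum_range_saw_sq m
  have hKpos : 0 < K := by
    have hN' : (0 : ℝ) < N := by exact_mod_cast hN
    have hP : (0 : ℝ) < ((N * L ^ k : ℕ) : ℝ) := by
      have : 0 < N * L ^ k := Nat.mul_pos (by omega) (by omega)
      exact_mod_cast this
    positivity
  have hX' : c * (K * A + K * B) ≤ K * A := by
    have e1 : ((N * L ^ k : ℕ) : ℝ) ^ (d - 1) * ((N : ℝ) * A) = K * A := by rw [hK]; ring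
    have e2 : ((N * L ^ k : ℕ) : ℝ) ^ (d - 1) * ((N : ℝ) * B) = K * B := by rw [hK]; ring
    rw [e1, e2] at hX; exact hX
  have hBpos : 0 < B := by
    rw [hBval]; have : (1 : ℝ) < (m : ℝ) ^ 2 := by nlinarith
    have : (0 : ℝ) < (m : ℝ) := by linarith
    positivity
  by_cases hc : c ≤ 0
  · exact hc.trans (by positivity)
  · have hc : 0 < c := lt_of_not_ge hc
    -- `c·B ≤ A` and `(m+1)·A = 12·B`
    have h1 : c * B ≤ A := by
      have : c * (A + B) ≤ A := by
        have := hX'; rw [← mul_add, ← mul_assoc, mul_comm c K, mul_assoc] at this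
        exact le_of_mul_le_mul_left this hKpos
      nlinarith [mul_nonneg hc.le (show 0 ≤ A by rw [hAval]; nlinarith)]
    have h2 : ((m : ℝ) + 1) * A = 12 * B := by rw [hAval, hBval]; ring
    rw [le_div_iff₀ hmpos]
    nlinarith

/-- **NO `k`-UNIFORM TANGENT COERCIVITY IN THE UNWEIGHTED LATTICE ENERGY NORM** (`d ≥ 2`, `L ≥ 2`, `N ≥ 1`): there is no
`c > 0` such that, for every level `k ≥ 1`, the Wilson Hessian at the flat background is `c`-coercive in `curlSq + dirSq` on
the constrained Landau tangent space of the torus of side `N·L^k` — the kernel form of GAPS G-ne7king10-1 (i): the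
`k`-free binder `{c}` of `NE3EnergyAssembly.ne3EnergyRate_of_routeLeaves` is not instantiable through leaf L5 ∕
`NE3HessShapes.tangentCoercive_of_poincare` in this currency. [folklore] -/
theorem not_tangentCoercive_uniform [Nonempty n] (hd : 2 ≤ d) {L N : ℕ} (hL : 2 ≤ L) (hN : 1 ≤ N) :
    ¬ ∃ c : ℝ, 0 < c ∧ ∀ k : ℕ, 1 ≤ k →
      TangentCoercive (flatCfg (d := d) (n := n)) (flatTangentLandau (d := d) (n := n) L N k) (periodBox (N * L ^ k)) c := by
  rintro ⟨c, hc, hall⟩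
  -- choose `k` with `L^k > 12/c`
  obtain ⟨k₀, hk₀⟩ := pow_unbounded_of_one_lt (12 / c) (by exact_mod_cast (by omega : 1 < L) : (1 : ℝ) < (L : ℝ))
  set k := k₀ + 1 with hkdef
  have hk : 1 ≤ k := by omega
  have hLk : 12 / c < (L : ℝ) ^ k := by
    refine hk₀.trans_le ?_
    exact pow_le_pow_right₀ (by exact_mod_cast (by omega : 1 ≤ L)) (by omega)
  have hle := tangentCoercive_flatCfg_le (n := n) hd hL hk hN
    (sawWave_mem_flatTangentLandau (N := N) hd (by omega) hk) (hall k hk)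
  have hpos : (0 : ℝ) < (L : ℝ) ^ k + 1 := by positivity
  rw [le_div_iff₀ hpos] at hle
  rw [div_lt_iff₀ hc] at hLk
  nlinarith

end Witness

end

end Summit.QuantumFields.BalabanUV.T4Continuum.NE3CoercivityScaling
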